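import Summits.HubbardSuperconductivity.HubbardSuperconductivity.Theorems.AnisotropyChordStiffnessDefs
import Summits.HubbardSuperconductivity.HubbardSuperconductivity.Theorems.AnisotropyChordXXZHoppingFormula

/-!
# Route `AnisotropyChord` / H0 rotor rung: matrix elements of the BOND CURRENT and of the BOND KINETIC
# operator of the spin-½ XXZ / hard-core boson torus (toolkit for the diamagnetic grid bound (S5)(c))

For distinct sites `x ≠ y` of the torus `(ℤ/L)²` and the operators of `AnisotropyChordStiffnessDefs`:

* `bondCurrent_mulVec_apply` — `(j_{xy} v)(σ) = ½[σ_x = 0, σ_y = 1] v(σ∘swap_{xy}) − ½[σ_x = 1, σ_y = 0] v(σ∘swap_{xy})`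
  (`j_{xy} = −i(Sˣ_xSʸ_y − Sʸ_xSˣ_y) = ½(S⁺_xS⁻_y − S⁺_yS⁻_x)`: a real antisymmetric hop);
* `kineticBond_mulVec_apply` — `((SˣSˣ + SʸSʸ)_{xy} v)(σ) = ½[σ_x ≠ σ_y] v(σ∘swap_{xy})`;
* `star_dotProduct_bondCurrent_mulVec`, `star_dotProduct_kineticBond_mulVec` — the corresponding
  sesquilinear forms as configuration sums over the flippable configurations of the bond.

Spin-½ entries from `spinVec_one_eq_half_spinHalfPauli`; single-site action `LiebMattis.onSite_mulVec_apply`.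
-/

set_option linter.dupNamespace false

noncomputable section

open Matrix Complex Finset
open scoped ComplexConjugate
open Literature.MathematicalPhysics.QuantumLattice hiding torusPhase torusNorm
open Literature.Probability.LatticeModels

namespace Summit.HubbardSuperconductivity.HubbardSuperconductivity.Theorems.AnisotropyChord.Stiffness

variable {L : ℕ} [NeZero L]

/-! ## Spin-½ entries -/

/-- Entries of `Sˣ` for spin ½: `⟨a|Sˣ|l⟩ = ½[a ≠ l]`. [folklore] -/
theorem spinVec_one_zero_apply (a l : Fin 2) :
    spinVec 1 0 a l = if a = l then 0 else (1 / 2 : ℂ) := by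
  rw [spinVec_one_eq_half_spinHalfPauli]
  fin_cases a <;> fin_cases l <;> simp [spinHalfPauli]

/-- Entries of `Sʸ` for spin ½: `⟨0|Sʸ|1⟩ = −i/2`, `⟨1|Sʸ|0⟩ = i/2`, diagonal `0`. [folklore] -/
theorem spinVec_one_one_apply (a l : Fin 2) :
    spinVec 1 1 a l = if a = l then 0 else if a = 0 then -(I / 2) else I / 2 := by
  rw [spinVec_one_eq_half_spinHalfPauli]
  fin_cases a <;> fin_cases l <;> simp [spinHalfPauli, div_eq_mul_inv, mul_comm]

omit [NeZero L] in
/-- The doubly flipped configuration of a flippable bond is the swapped configuration. [folklore] -/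
theorem update_update_eq_comp_swap {x y : TorusSite 2 L} (hxy : x ≠ y) (σ : TensorIndex (TorusSite 2 L) 2)
    {a b : Fin 2} (hx : σ x = a) (hy : σ y = b) :
    Function.update (Function.update σ x b) y a = σ ∘ Equiv.swap x y := by
  funext z
  simp only [Function.comp_apply]
  by_cases hzy : z = y
  · subst hzy
    rw [Function.update_self, Equiv.swap_apply_right, hx]
  · rw [Function.update_of_ne hzy]
    by_cases hzx : z = x
    · subst hzx
      rw [Function.update_self, Equiv.swap_apply_left, hy]
    · rw [Function.update_of_ne hzx, Equiv.swap_apply_of_ne_of_ne hzx hzy]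

/-- The two-site product action: `((a_x b_y) v)(σ) = Σ_{l,l'} a(σ_x,l) b(σ_y,l') v(σ[x↦l][y↦l'])` (`x ≠ y`). [folklore] -/
theorem onSite_mul_onSite_mulVec_apply {x y : TorusSite 2 L} (hxy : x ≠ y) (a b : Matrix (Fin 2) (Fin 2) ℂ)
    (v : TensorIndex (TorusSite 2 L) 2 → ℂ) (σ : TensorIndex (TorusSite 2 L) 2) :
    ((onSite x a * onSite y b : Op (TorusSite 2 L) 2) *ᵥ v) σ
      = ∑ l : Fin 2, ∑ l' : Fin 2, a (σ x) l * b (σ y) l' *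
          v (Function.update (Function.update σ x l) y l') := by
  rw [← Matrix.mulVec_mulVec, LiebMattis.onSite_mulVec_apply]
  refine Finset.sum_congr rfl fun l _ => ?_
  rw [LiebMattis.onSite_mulVec_apply, Function.update_of_ne (Ne.symm hxy), Finset.mul_sum]
  refine Finset.sum_congr rfl fun l' _ => ?_
  ring

/-! ## The bond current -/

/-- **Action of the bond current** (`x ≠ y`):
`(j_{xy} v)(σ) = ½[σ_x = 0 ∧ σ_y = 1] v(σ∘swap) − ½[σ_x = 1 ∧ σ_y = 0] v(σ∘swap)`. [folklore] -/
theorem bondCurrent_mulVec_apply {x y : TorusSite 2 L} (hxy : x ≠ y)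
    (v : TensorIndex (TorusSite 2 L) 2 → ℂ) (σ : TensorIndex (TorusSite 2 L) 2) :
    (bondCurrent L x y *ᵥ v) σ
      = if σ x = 0 ∧ σ y = 1 then (1 / 2 : ℂ) * v (σ ∘ Equiv.swap x y)
        else if σ x = 1 ∧ σ y = 0 then -(1 / 2 : ℂ) * v (σ ∘ Equiv.swap x y) else 0 := by
  unfold bondCurrent siteSpin
  rw [Matrix.smul_mulVec, Pi.smul_apply, smul_eq_mul, Matrix.sub_mulVec, Pi.sub_apply,
    onSite_mul_onSite_mulVec_apply hxy, onSite_mul_onSite_mulVec_apply hxy]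
  simp only [Fin.sum_univ_two, spinVec_one_zero_apply, spinVec_one_one_apply]
  have fin2 : ∀ t : Fin 2, t = 0 ∨ t = 1 := by decide
  rcases fin2 (σ x) with hx | hx <;> rcases fin2 (σ y) with hy | hy
  · simp [hx, hy]; ring
  · rw [update_update_eq_comp_swap hxy σ hx hy]; simp [hx, hy]; ring_nf; rw [Complex.I_sq]; ring
  · rw [update_update_eq_comp_swap hxy σ hx hy]; simp [hx, hy]; ring_nf; rw [Complex.I_sq]; ring
  · simp [hx, hy]; ring

/-! ## The bond kinetic operator -/

/-- For distinct sites the symmetrised bond operator is the plain product: `spinBond α x y = S^α_x S^α_y`. [folklore] -/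
theorem spinBond_eq_mul {x y : TorusSite 2 L} (hxy : x ≠ y) (α : Fin 3) :
    (spinBond 1 α x y : Op (TorusSite 2 L) 2) = siteSpin 1 x α * siteSpin 1 y α := by
  unfold spinBond siteSpin
  have hc : (onSite y (spinVec 1 α) * onSite x (spinVec 1 α) : Op (TorusSite 2 L) 2)
      = onSite x (spinVec 1 α) * onSite y (spinVec 1 α) := onSite_mul_onSite_comm (Ne.symm hxy) _ _
  have h2 : (onSite x (spinVec 1 α) * onSite y (spinVec 1 α) : Op (TorusSite 2 L) 2)
      + onSite x (spinVec 1 α) * onSite y (spinVec 1 α)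
      = (2 : ℂ) • (onSite x (spinVec 1 α) * onSite y (spinVec 1 α)) := (two_smul ℂ _).symm
  simp only [hc, h2, smul_smul]
  norm_num

/-- **Action of the bond kinetic operator** (`x ≠ y`):
`((Sˣ_xSˣ_y + Sʸ_xSʸ_y) v)(σ) = ½[σ_x ≠ σ_y] v(σ∘swap)`. [folklore] -/
theorem kineticBond_mulVec_apply {x y : TorusSite 2 L} (hxy : x ≠ y)
    (v : TensorIndex (TorusSite 2 L) 2 → ℂ) (σ : TensorIndex (TorusSite 2 L) 2) :
    ((spinBond 1 0 x y + spinBond 1 1 x y : Op (TorusSite 2 L) 2) *ᵥ v) σ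
      = if σ x ≠ σ y then (1 / 2 : ℂ) * v (σ ∘ Equiv.swap x y) else 0 := by
  rw [spinBond_eq_mul hxy, spinBond_eq_mul hxy]
  unfold siteSpin
  rw [Matrix.add_mulVec, Pi.add_apply, onSite_mul_onSite_mulVec_apply hxy, onSite_mul_onSite_mulVec_apply hxy]
  simp only [Fin.sum_univ_two, spinVec_one_zero_apply, spinVec_one_one_apply]
  have fin2 : ∀ t : Fin 2, t = 0 ∨ t = 1 := by decide
  rcases fin2 (σ x) with hx | hx <;> rcases fin2 (σ y) with hy | hy
  · simp [hx, hy]; ring_nf; rw [Complex.I_sq]; ring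
  · rw [update_update_eq_comp_swap hxy σ hx hy]; simp [hx, hy]; ring_nf; rw [Complex.I_sq]; ring
  · rw [update_update_eq_comp_swap hxy σ hx hy]; simp [hx, hy]; ring_nf; rw [Complex.I_sq]; ring
  · simp [hx, hy]; ring_nf; rw [Complex.I_sq]; ring

/-! ## The forms -/

/-- **The current form:** `⟨φ, j_{xy} ψ⟩ = ½ Σ_σ conj φ(σ) ([σ_x=0,σ_y=1] − [σ_x=1,σ_y=0]) ψ(σ∘swap)`. [folklore] -/
theorem star_dotProduct_bondCurrent_mulVec {x y : TorusSite 2 L} (hxy : x ≠ y)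
    (φ ψ : TensorIndex (TorusSite 2 L) 2 → ℂ) :
    star φ ⬝ᵥ (bondCurrent L x y *ᵥ ψ)
      = ∑ σ, conj (φ σ) *
          (if σ x = 0 ∧ σ y = 1 then (1 / 2 : ℂ) * ψ (σ ∘ Equiv.swap x y)
            else if σ x = 1 ∧ σ y = 0 then -(1 / 2 : ℂ) * ψ (σ ∘ Equiv.swap x y) else 0) := by
  rw [dotProduct]
  refine Finset.sum_congr rfl fun σ _ => ?_
  rw [Pi.star_apply, bondCurrent_mulVec_apply hxy]
  rfl

/-- **The kinetic form:** `⟨φ, (SˣSˣ+SʸSʸ)_{xy} ψ⟩ = ½ Σ_{σ : σ_x ≠ σ_y} conj φ(σ) ψ(σ∘swap)`. [folklore] -/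
theorem star_dotProduct_kineticBond_mulVec {x y : TorusSite 2 L} (hxy : x ≠ y)
    (φ ψ : TensorIndex (TorusSite 2 L) 2 → ℂ) :
    star φ ⬝ᵥ ((spinBond 1 0 x y + spinBond 1 1 x y : Op (TorusSite 2 L) 2) *ᵥ ψ)
      = ∑ σ, conj (φ σ) * (if σ x ≠ σ y then (1 / 2 : ℂ) * ψ (σ ∘ Equiv.swap x y) else 0) := by
  rw [dotProduct]
  refine Finset.sum_congr rfl fun σ _ => ?_
  rw [Pi.star_apply, kineticBond_mulVec_apply hxy]
  rfl

end Summit.HubbardSuperconductivity.HubbardSuperconductivity.Theorems.AnisotropyChord.Stiffness
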